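import Literature.AlgebraicGeometry.AbelianSchemes.PELTupleStageLocalise   -- ★ (GS-2-core): stage currency, `hom_eq_of_mono_hom`
import Mathlib.AlgebraicGeometry.Morphisms.Preimmersion
import HarnessLib

/-!
# The localisation leg `P ×_A Spec T → P ×_A Q` is injective on points of any scheme when `Spec T → Spec A` is a monomorphism
# (gap G3 of the `stub_INJ0` zip: `stageLocLeg` is injective on geometric points)

Topic `AlgebraicGeometry/Limits`; namespace `Literature.AlgebraicGeometry.Limits.LocApprox`.  THEOREMS ONLY (no definition, no instance, no notation, no named
fact, no `sorry`).  Cell `hodgecm-mathlib` (D-0151), P6 «MOD programme» (crux hLiu418 = stmt-HodgeConjecture-24832, `--supports`, count-neutral); P-LINE ED. 2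
leaf `Lines/F0_P6a_PELSpread.lean`, socket `stub_INJ0` (LEAD F0P6-plan (g3) «M-55b» (2); A-p14 (g35) dossier step 3; LA4-plan (g0) DEAL v3, LA4-p03).
HC_CM is proved only modulo the printed citations until rung 0 closes; nothing here is about HC.

THE MATHEMATICS ([GortzWedhorn2020] (4.7), Cor. 10.64 (2); [EGAIV3] (8.8.2.5); [StacksProject] Tag 01L1 ∕ 04XV (preimmersions are monomorphisms)).  In the
cartesian-monoidal category `Over (Spec A)`, for an object `Q` whose structure morphism `Q → Spec A` is a MONOMORPHISM (e.g. `Q = Spec A_𝔭`, `Spec` of a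
localisation, Mathlib `IsPreimmersion.of_isLocalization`) every `A`-morphism into `Q` is unique (★ `hom_eq_of_mono_hom`); hence for ANY `τ : Q → R` over `A` and any
`P`, the whiskered map `(P ◁ τ) : P ⊗ Q → P ⊗ R` is injective on `X`-valued points of the total spaces for every scheme `X` — two points of `(P ⊗ Q).left` with
the same image have the same first component (`fst`, unchanged by `P ◁ τ`) and the same second component (unique).  USE: the localisation leg
`stageLocLeg 𝓜 w t τ = (𝓜.total ◁ τ).left : 𝓨_(w) → 𝓜.total ⊗ D(t)` of the `stub_INJ0` letter (desk leaf cand v4g :90), `Q = specOver (𝓞 F) 𝒪_{F,(w)}` with Mathlib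
`IsLocalization (w.asIdeal.primeCompl) (valuationSubringAtPrime F w)`, is injective on geometric points — the `hℓ` binder of ★ (GS-3d)
`exists_finset_forall_eq_of_tupleIsoAt_of_pointwise`.

* `whiskerLeft_left_comp_injective_of_mono_hom` — THE HEAD (any `[Mono Q.hom]`).
* `mono_specOver_hom_of_isLocalization` — `Spec` of a localisation is a monomorphism (Mathlib preimmersion).
* `whiskerLeft_left_comp_injective_of_isLocalization` — the localisation form.

## References
* [GortzWedhorn2020] U. Görtz, T. Wedhorn, *Algebraic Geometry I*, 2nd ed. (2020), Section (4.7) (pp. 107–108); Cor. 10.64 (2) (p. 329).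
* [EGAIV3] A. Grothendieck, *ÉGA* IV₃ (1966), (8.8.2.5).
* [StacksProject] The Stacks Project, Tag 01L1.
-/

set_option autoImplicit false

noncomputable section

-- Mathlib's `Over`/pull-back API is stated across semireducible wrappers (as in the ★ `Limits/*` files).
set_option backward.isDefEq.respectTransparency false

universe u

open CategoryTheory CategoryTheory.Limits AlgebraicGeometry MonoidalCategory CartesianMonoidalCategory

namespace Literature.AlgebraicGeometry.Limits

namespace LocApprox

open Literature.AlgebraicGeometry.Motives (SchemeOver specOver)

/-- **`(P ◁ τ).left` IS INJECTIVE ON POINTS when `Q → Spec A` is a monomorphism**: for `τ : Q ⟶ R` in `Over (Spec A)` and points `x₁ x₂ : X ⟶ (P ⊗ Q).left`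
with `x₁ ≫ (P ◁ τ).left = x₂ ≫ (P ◁ τ).left`, `x₁ = x₂` (first components through `fst`, ★ `whiskerLeft_fst`; second components unique into `Q`, ★
`hom_eq_of_mono_hom`). [cite: GortzWedhorn2020, Section (4.7) (pp. 107–108)] [cite: StacksProject, Tag 01L1] -/
theorem whiskerLeft_left_comp_injective_of_mono_hom {A : Type u} [CommRing A] (P : SchemeOver A) {Q R : SchemeOver A} [Mono Q.hom] (τ : Q ⟶ R)
    {X : Scheme.{u}} (x₁ x₂ : X ⟶ (P ⊗ Q).left) (h : x₁ ≫ (P ◁ τ).left = x₂ ≫ (P ◁ τ).left) : x₁ = x₂ := by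
  -- both points as `A`-morphisms from `X` structured by `x₁`
  have w₂ : x₂ ≫ (P ⊗ Q).hom = x₁ ≫ (P ⊗ Q).hom := by
    rw [← Over.w (P ◁ τ), ← Category.assoc, ← h, Category.assoc]
  let X' : SchemeOver A := Over.mk (x₁ ≫ (P ⊗ Q).hom)
  let a : X' ⟶ P ⊗ Q := Over.homMk x₁ rfl
  let b : X' ⟶ P ⊗ Q := Over.homMk x₂ w₂
  have hab : a ≫ (P ◁ τ) = b ≫ (P ◁ τ) := Over.OverMorphism.ext (by
    change x₁ ≫ (P ◁ τ).left = x₂ ≫ (P ◁ τ).left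
    exact h)
  have key : a = b := by
    apply CartesianMonoidalCategory.hom_ext
    · have := congrArg (· ≫ fst P R) hab
      simpa only [Category.assoc, whiskerLeft_fst] using this
    · exact hom_eq_of_mono_hom _ _ _
  exact congrArg CommaMorphism.left key

/-- **`Spec T → Spec A` is a monomorphism for a localisation `T = A_S`** (Mathlib: a preimmersion, `IsPreimmersion.of_isLocalization`).
[cite: StacksProject, Tag 01L1] [cite: GortzWedhorn2020, Cor. 10.64 (2) (p. 329)] -/
theorem mono_specOver_hom_of_isLocalization {A : Type u} [CommRing A] (M : Submonoid A) (T : Type u) [CommRing T] [Algebra A T] [IsLocalization M T] :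
    Mono (specOver A T).hom := by
  haveI : IsPreimmersion (Spec.map (CommRingCat.ofHom (algebraMap A T))) := IsPreimmersion.of_isLocalization M
  exact inferInstanceAs (Mono (Spec.map (CommRingCat.ofHom (algebraMap A T))))

/-- **The localisation form**: for `T = A_M` a localisation and any `τ : specOver A T ⟶ R` over `A`, `(P ◁ τ).left` is injective on `X`-points — in particular the
leg `𝓨_(w) = 𝓜.total ⊗ Spec 𝒪_{F,(w)} → 𝓜.total ⊗ D(t)` of the P6a stage is injective on geometric points. [cite: EGAIV3, (8.8.2.5)]
[cite: GortzWedhorn2020, Section (4.7) (pp. 107–108)] -/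
theorem whiskerLeft_left_comp_injective_of_isLocalization {A : Type u} [CommRing A] (M : Submonoid A) (T : Type u) [CommRing T] [Algebra A T]
    [IsLocalization M T] (P : SchemeOver A) {R : SchemeOver A} (τ : specOver A T ⟶ R)
    {X : Scheme.{u}} (x₁ x₂ : X ⟶ (P ⊗ specOver A T).left) (h : x₁ ≫ (P ◁ τ).left = x₂ ≫ (P ◁ τ).left) : x₁ = x₂ :=
  haveI := mono_specOver_hom_of_isLocalization M T
  whiskerLeft_left_comp_injective_of_mono_hom P τ x₁ x₂ h

end LocApprox

end Literature.AlgebraicGeometry.Limits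

end
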